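import Summits.BirchSwinnertonDyer.BirchSwinnertonDyer.Theorems.KolyvaginDepthDoorKolyvaginDepthSupplyCalibration
import Summits.BirchSwinnertonDyer.BirchSwinnertonDyer.Theorems.Rank2ObservatoryPadicAtlasKit
import HarnessLib

/-!
# Route `KolyvaginDepthDoor` — the AGREEMENT instrument filled from the λ-side: the crux's clause AT A
# CURVE from a cyclotomic (`p`-adic `L`-function) certificate, no derived-class computation
# (crux `KolyvaginDepthSupply`, stmt-BirchSwinnertonDyer-21765)

Helper file (`--supports stmt-BirchSwinnertonDyer-21765 --as helper`); it closes nothing and BSD is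
not proved by it. HONEST FRAMING: per-curve theorems, CONDITIONAL on named literature facts (all
theorems in print) and, for the atlas cells, on the modular-symbol DATA hypotheses of the tree's
`p`-adic atlas; the crux (class-wide = X1 on non-CM curves at a surjective prime, g0's calibration
`kolyvaginDepthSupply_iff_shaCorankZeroSurj_nonCM`) stays OPEN.

The route header pairs two NON-EQUIVALENT per-curve criteria for X1 (`t_p := corank_ℤ_p Ш(E)[p^∞] = 0`)
at rank `2` and asks for their AGREEMENT as an instrument row: the anticyclotomic DEPTH door (a
computed non-zero Kolyvagin–Heegner class `c_M(ℓ) ≠ 0` at depth `1 = rank − 1`; the tree's depth-table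
rows `C<label>.depthRow_…` / `C<label>.kolyvaginDepthSupply_clause`, modulo Kolyvagin 1991 Thm. 4 and
the COMPUTED bit) and the cyclotomic λ-door (`ord_T L_p(E,T) = 2`, Stein–Wuthrich; the tree's
kernel-checked `p`-adic atlas `Rank2ObservatoryPadicAtlas*`, whose cells give `rank = 2 = corank
Sel_{p^∞}` modulo Perrin-Riou–Schneider, Kato 17.4, the newform and the symbol data). This file goes
λ-row ⟹ depth row AT THE CURVE, in the crux's own wording:

* `kolyvaginDepthSupply_clause_of_shaCorank_eq_zero_of_two_le_rank` — **per-curve supply at rank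
  `≥ 2`.** For `W` globally minimal with `2 ≤ rank_ℤ E(ℚ)` and a prime `p ≥ 5` of good ordinary
  reduction with `ρ̄_{E,p}` onto and `t_p(E) = 0`, the CLAUSE of `KolyvaginDepthSupply` holds at `W`
  verbatim (with this `p`; the Heegner field `K` is supplied by Bump–Friedberg–Hoffstein /
  Hoffstein–Luo, the non-zero class by BCGS 2026 Thm. 1, its depth `rank − 1` and the rank clause by
  Kolyvagin 1991 Thm. 4 + Kummer + GZK on the twist) — modulo the six named facts `hA hF hmod hHL hBFH
  hGZK` of g0's calibration (no `p`-parity needed at rank `≥ 2`). This is the pointwise content of the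
  `←` direction of `kolyvaginDepthSupply_iff_shaCorankZeroSurj_nonCM`, exposed per curve.
* `exists_kolyvaginPrime_class_ne_zero_of_shaCorank_eq_zero_of_rank_two` — at rank EXACTLY `2` the
  witness sits on ONE Kolyvagin prime `ℓ`: the depth table's bit `c_M(ℓ) ≠ 0` is PREDICTED (for some
  admissible `K`, some `ℓ`, some level `M ≤ M(ℓ)`) by `t_p = 0`.
* `kolyvaginDepthSupply_clause_of_atlasCell` — **the λ-join.** For a curve `C` of the `p`-adic atlas
  passing its kernel test and a cell `c ∈ C.cells` (prime `p = c.p`), GIVEN the atlas's named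
  hypotheses (`hPRS`, `hkato`, newform `hf`, rank certificate `hlow`, symbol data `D, hD, hint, htab`)
  and `ρ̄_{E,p}` onto, the clause of `KolyvaginDepthSupply` holds at `W = C.e ⊗ ℚ`: the atlas row
  (`AtlasCurve.padicRow`: `rank = 2`, `corank Sel_{p^∞} = 2`) gives `t_p = 0` by the Greenberg/Kummer
  identity, then the per-curve supply applies.
* `exists_kolyvaginPrime_class_ne_zero_of_atlasCell` — the same join in the depth table's own
  currency: a Kolyvagin PRIME `ℓ` with `c_M(ℓ) ≠ 0` and no non-zero class at depth `0`.

The sequel `KolyvaginDepthDoorDepthTableLambdaJoinRows` instantiates the join at the 18 depth-table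
curves (`Rank2ObservatoryPadicAtlasR2A00/01` cells at `p = 5`, `7` for `655a1`; `ρ̄` onto and `2 ≤ rank`
are kernel theorems of the tree there), next to g2's `C<label>.kolyvaginDepthSupply_clause` (the same
clause from the depth-table bit `c_1(ℓ) ≠ 0` modulo `hF` alone).

So at every depth-table curve BOTH doors yield the crux's clause, on trust bases sharing ONLY Kolyvagin
Thm. 4: {Kolyvagin Thm. 4, one derived-class computation} versus {BCGS, Kolyvagin Thm. 4, modularity,
HL, BFH, GZK, Schneider/Perrin-Riou, Kato 17.4, one modular-symbol table}. Neither is a class theorem.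

References: [Kolyvagin1991MathAnn] §2 Thm. 4; [BurungaleEtAl2026] arXiv:2312.09301 Thm. 1;
[WZhang2014] Thm. 1.2, Thm. 11.2 (i); [SteinWuthrich2013] Thm. 1.1, §3; [MazurTateTeitelbaum1986Invent]
§I.10–I.13; [Kato2004Asterisque] Thm. 17.4; [BalakrishnanMullerStein2015] Thm. 1.7;
[HoffsteinLuo1997]; [BumpFriedbergHoffstein1990]; [Darmon2004] Thm. 3.22; [GreenbergLNM1716] §1;
[JetchevLauterStein2009] arXiv:0707.0032 §3.6.
-/

set_option linter.dupNamespace false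

noncomputable section

open scoped Classical

namespace Summit.BirchSwinnertonDyer.BirchSwinnertonDyer.Theorems.KolyvaginDepthDoor

open Literature.NumberTheory.EllipticCurves Literature.NumberTheory.EllipticCurves.ModularForms
  WeierstrassCurve CongruenceSubgroup
open Summit.BirchSwinnertonDyer.BirchSwinnertonDyer.Theorems
open Summit.BirchSwinnertonDyer.BirchSwinnertonDyer.Rank2Observatory

/-! ## §1 Per-curve supply at rank `≥ 2`: `t_p = 0` at a big-image prime gives the crux's clause -/

/-- **Per-curve supply at rank `≥ 2`, core form (modulo six theorems in print).** Named facts: `hA`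
BCGS 2026 Thm. 1 (Kolyvagin's conjecture, `p > 3` good ordinary, `E[p]` irreducible), `hF` Kolyvagin
1991 Thm. 4 (the route's support item `KolyvaginStructure`), `hmod` modularity, `hHL` Hoffstein–Luo
1997, `hBFH` Bump–Friedberg–Hoffstein 1990, `hGZK` Gross–Zagier–Kolyvagin. Data: `W/ℚ` globally
minimal with `2 ≤ rank_ℤ E(ℚ)`; `p ≥ 5` of good ordinary reduction with `ρ̄_{E,p}` onto and
`corank_ℤ_p Ш(E)[p^∞] = 0`. Conclusion, AT THIS `p`: an admissible Heegner field `K` (`d_K ∉ {−3,−4}`,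
`p ∤ d_K N_E`, Heegner hypothesis for `N_E`), a frame `(Dt, β, ι)` and a non-zero Kolyvagin–Heegner
class `c_M(n) ≠ 0` (`n` a square-free product of Kolyvagin primes, `1 ≤ M ≤ M(n)`), depth-minimal
among the non-zero classes of its system, of depth `ν(n) = rank − 1`, with `rank E^{(d_K)}(ℚ) <
rank E(ℚ)`. Proof: HK (`stub_heegner_field_supply_of_facts`) supplies `K` with `d_K` odd, `p` split
and `ord L(E^{(d_K)}) ≤ 1`; HT/GZK give `corank Sel_{p^∞}(E^{(d_K)}) = rank E^{(d_K)} =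
ord L(E^{(d_K)}) ≤ 1 ≤ rank − 1`; the supply theorem `exists_kolyvaginClass_ne_zero_depth_eq_rank_sub_one`
(BCGS + Kolyvagin at the minimiser) gives the class. CONDITIONAL on the six facts; per-curve; BSD is
not proved by it. [cite: BurungaleEtAl2026, Thm. 1 (arXiv:2312.09301 §0.1)]
[cite: Kolyvagin1991MathAnn, §2 Thm. 4] [cite: Darmon2004, Thm. 3.22]
[cite: GreenbergLNM1716, §1 pp. 54–57] -/
theorem exists_heegnerField_minimal_class_of_shaCorank_eq_zero_of_two_le_rank
    (hA : BurungaleEtAl2026_exists_kolyvaginClass_ne_zero)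
    (hF : Kolyvagin1991_selmerCorank_of_kolyvaginClass_ne_zero)
    (hmod : exists_isNewformOf) (hHL : HoffsteinLuo1997_exists_twist_L_one_ne_zero)
    (hBFH : bumpFriedbergHoffstein_exists_heegnerField_split_twist_simpleZero)
    (hGZK : rank_eq_analyticRank_of_analyticRank_le_one)
    (W : WeierstrassCurve ℚ) [W.IsElliptic] [W.IsGloballyMinimal] (hr : 2 ≤ W.mordellWeilRank)
    (p : ℕ) [hp : Fact p.Prime] (h5 : 5 ≤ p) (hgood : W.HasGoodReductionAtPrime p)
    (hord : ¬ (p : ℤ) ∣ W.frobeniusTrace p) (hsurj : W.HasSurjectiveModNGaloisRep p)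
    (ht : W.shaCorank p = 0) :
    ∃ (K : Type) (_ : Field K) (_ : NumberField K), IsImaginaryQuadratic K ∧
      NumberField.discr K ≠ -3 ∧ NumberField.discr K ≠ -4 ∧ ¬ ((p : ℤ) ∣ NumberField.discr K) ∧
      ¬ (p ∣ W.conductorNorm ℤ) ∧ ∃ (_ : NeZero (W.conductorNorm ℤ)),
      SatisfiesHeegnerHypothesis (W.conductorNorm ℤ) K ∧
      ∃ (Dt : ModularParametrizationData W (W.conductorNorm ℤ)) (β : ℤ) (ι : K →+* ℂ) (n : ℕ)
        (d : KolyvaginHeegnerData Dt β ι n) (M : ℕ),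
        KolyvaginDescent.KolSupp (Zhang2014.IsKolyvaginPrime (W.conductorNorm ℤ) W K p) n ∧
        1 ≤ M ∧ (M : ℕ∞) ≤ Zhang2014.levelIndex W p n ∧ d.kolyvaginClass hp.out M ≠ 0 ∧
        (∀ (n' : ℕ) (d' : KolyvaginHeegnerData Dt β ι n') (M' : ℕ),
          KolyvaginDescent.KolSupp (Zhang2014.IsKolyvaginPrime (W.conductorNorm ℤ) W K p) n' →
          1 ≤ M' → (M' : ℕ∞) ≤ Zhang2014.levelIndex W p n' → d'.kolyvaginClass hp.out M' ≠ 0 →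
          n.primeFactors.card ≤ n'.primeFactors.card) ∧
        n.primeFactors.card + 1 = W.mordellWeilRank ∧
        (W.quadraticTwist (NumberField.discr K : ℚ)).mordellWeilRank < W.mordellWeilRank := by
  -- HK: an admissible Heegner field with `ord L(E^K) ≤ 1`
  obtain ⟨K, iF, iN, hK, h3, h4, hpd, hH, hodd, hps, hle, -⟩ :=
    stub_heegner_field_supply_of_facts hmod hHL hBFH W p h5 hgood hord hsurj
  -- HT: `c' = ord L(E^K)`; GZK on the twist: `rank E^K = ord L(E^K)`
  have hc' : (W.quadraticTwist (NumberField.discr K : ℚ)).selmerCorank p =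
      (W.quadraticTwist (NumberField.discr K : ℚ)).analyticRank :=
    stub_twist_corank_eq_of_facts hGZK W p h5 hgood hord hsurj K hK h3 h4 hpd hH hle
  have hdK : (NumberField.discr K : ℚ) ≠ 0 := by exact_mod_cast NumberField.discr_ne_zero K
  haveI := W.isElliptic_quadraticTwist hdK
  have hr' : (W.quadraticTwist (NumberField.discr K : ℚ)).mordellWeilRank =
      (W.quadraticTwist (NumberField.discr K : ℚ)).analyticRank := (hGZK _ hle).1
  have hpN : ¬ (p ∣ W.conductorNorm ℤ) := fun h' ↦
    (W.dvd_conductorNorm_iff_not_hasGoodReductionAtPrime p).mp h' hgood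
  haveI iNZ : NeZero (W.conductorNorm ℤ) := ⟨(W.conductorNorm_pos_holds).ne'⟩
  -- `c' ≤ 1 ≤ rank − 1`: supply at depth `rank − 1`
  have hcle : (W.quadraticTwist (NumberField.discr K : ℚ)).selmerCorank p + 1 ≤
      W.mordellWeilRank := by
    rw [hc']; omega
  obtain ⟨Dt, β, ι, n, d, M, hΛ, hM, hMle, hne, hcard, hmin⟩ :=
    exists_kolyvaginClass_ne_zero_depth_eq_rank_sub_one hA hF W p h5 hgood hord hsurj K hK h3 h4 hpd
      hH hodd hps hcle ht
  refine ⟨K, iF, iN, hK, h3, h4, hpd, hpN, iNZ, hH, Dt, β, ι, n, d, M, hΛ, hM, hMle, hne, hmin, hcard,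
    ?_⟩
  omega

/-- **Per-curve supply at rank `≥ 2`: the crux's CLAUSE at `W` (modulo six theorems in print).** For
`W/ℚ` globally minimal with `2 ≤ rank_ℤ E(ℚ)` and a prime `p ≥ 5` of good ordinary reduction with
`ρ̄_{E,p}` onto and `corank_ℤ_p Ш(E)[p^∞] = 0`, the clause of `KolyvaginDepthSupply`
(`kolyvaginDepthSupply_iff_forall_clause`) holds at `W` VERBATIM — witnessed by this `p`, the Heegner
field and the depth-minimal class of
`exists_heegnerField_minimal_class_of_shaCorank_eq_zero_of_two_le_rank`, first rank clause
`ν(n) + 1 = rank E(ℚ) > rank E^{(d_K)}(ℚ)`. This is the pointwise content of the `←` direction of g0's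
calibration `kolyvaginDepthSupply_iff_shaCorankZeroSurj_nonCM` (no `p`-parity needed at rank `≥ 2`);
it turns ANY per-curve certificate of X1 at a big-image prime — in particular a λ-door row — into the
crux's clause at that curve. CONDITIONAL on the six facts; per-curve; BSD is not proved by it.
[cite: BurungaleEtAl2026, Thm. 1 (arXiv:2312.09301 §0.1)] [cite: Kolyvagin1991MathAnn, §2 Thm. 4]
[cite: Darmon2004, Thm. 3.22] -/
theorem kolyvaginDepthSupply_clause_of_shaCorank_eq_zero_of_two_le_rank
    (hA : BurungaleEtAl2026_exists_kolyvaginClass_ne_zero)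
    (hF : Kolyvagin1991_selmerCorank_of_kolyvaginClass_ne_zero)
    (hmod : exists_isNewformOf) (hHL : HoffsteinLuo1997_exists_twist_L_one_ne_zero)
    (hBFH : bumpFriedbergHoffstein_exists_heegnerField_split_twist_simpleZero)
    (hGZK : rank_eq_analyticRank_of_analyticRank_le_one)
    (W : WeierstrassCurve ℚ) [W.IsElliptic] [W.IsGloballyMinimal] (hr : 2 ≤ W.mordellWeilRank)
    (p : ℕ) [hp : Fact p.Prime] (h5 : 5 ≤ p) (hgood : W.HasGoodReductionAtPrime p)
    (hord : ¬ (p : ℤ) ∣ W.frobeniusTrace p) (hsurj : W.HasSurjectiveModNGaloisRep p)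
    (ht : W.shaCorank p = 0) :
    ∃ (p : ℕ) (hp : Fact p.Prime), 5 ≤ p ∧ W.HasGoodReductionAtPrime p ∧ ¬ (p : ℤ) ∣
      W.frobeniusTrace p ∧ W.HasSurjectiveModNGaloisRep p ∧ ∃ (K : Type) (_ : Field K) (_ :
      NumberField K), Literature.NumberTheory.EllipticCurves.IsImaginaryQuadratic K ∧
      NumberField.discr K ≠ -3 ∧ NumberField.discr K ≠ -4 ∧ ¬ ((p : ℤ) ∣ NumberField.discr K) ∧ ¬ (p
      ∣ W.conductorNorm ℤ) ∧ ∃ (_ : NeZero (W.conductorNorm ℤ)),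
      Literature.NumberTheory.EllipticCurves.SatisfiesHeegnerHypothesis (W.conductorNorm ℤ) K ∧ ∃
      (Dt : Literature.NumberTheory.EllipticCurves.ModularForms.ModularParametrizationData W
      (W.conductorNorm ℤ)) (β : ℤ) (ι : K →+* ℂ) (n : ℕ) (d :
      Literature.NumberTheory.EllipticCurves.KolyvaginHeegnerData Dt β ι n) (M : ℕ),
      Literature.NumberTheory.EllipticCurves.KolyvaginDescent.KolSupp
      (Literature.NumberTheory.EllipticCurves.Zhang2014.IsKolyvaginPrime (W.conductorNorm ℤ) W K p)
      n ∧ 1 ≤ M ∧ (M : ℕ∞) ≤ Literature.NumberTheory.EllipticCurves.Zhang2014.levelIndex W p n ∧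
      d.kolyvaginClass hp.out M ≠ 0 ∧ (∀ (n' : ℕ) (d' :
      Literature.NumberTheory.EllipticCurves.KolyvaginHeegnerData Dt β ι n') (M' : ℕ),
      Literature.NumberTheory.EllipticCurves.KolyvaginDescent.KolSupp
      (Literature.NumberTheory.EllipticCurves.Zhang2014.IsKolyvaginPrime (W.conductorNorm ℤ) W K p)
      n' → 1 ≤ M' → (M' : ℕ∞) ≤ Literature.NumberTheory.EllipticCurves.Zhang2014.levelIndex W p n' →
      d'.kolyvaginClass hp.out M' ≠ 0 → n.primeFactors.card ≤ n'.primeFactors.card) ∧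
      ((n.primeFactors.card + 1 = W.mordellWeilRank ∧ (W.quadraticTwist (NumberField.discr K :
      ℚ)).mordellWeilRank < W.mordellWeilRank) ∨ (n.primeFactors.card = W.mordellWeilRank ∧
      (W.quadraticTwist (NumberField.discr K : ℚ)).mordellWeilRank = W.mordellWeilRank + 1)) := by
  obtain ⟨K, iF, iN, hK, h3, h4, hpd, hpN, iNZ, hH, Dt, β, ι, n, d, M, hΛ, hM, hMle, hne, hmin, hcard,
    hlt⟩ :=
    exists_heegnerField_minimal_class_of_shaCorank_eq_zero_of_two_le_rank hA hF hmod hHL hBFH hGZK W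
      hr p h5 hgood hord hsurj ht
  exact ⟨p, hp, h5, hgood, hord, hsurj, K, iF, iN, hK, h3, h4, hpd, hpN, iNZ, hH, Dt, β, ι, n, d, M, hΛ,
    hM, hMle, hne, hmin, Or.inl ⟨hcard, hlt⟩⟩

/-- **At rank exactly `2` the predicted witness is ONE Kolyvagin prime** (modulo the same six facts).
`W/ℚ` globally minimal with `rank_ℤ E(ℚ) = 2`; `p ≥ 5` good ordinary with `ρ̄_{E,p}` onto and
`corank_ℤ_p Ш(E)[p^∞] = 0`. Then for some admissible Heegner field `K` (`d_K ∉ {−3,−4}`,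
`p ∤ d_K N_E`, Heegner hypothesis), some frame `(Dt, β, ι)`, some Kolyvagin PRIME `ℓ` for `(E, K, p)`
(W. Zhang's sense: `ℓ ∤ N d_K p`, inert in `K`, `M(ℓ) ≥ 1`) and some level `1 ≤ M ≤ M(ℓ)`, a
Kolyvagin–Heegner datum of conductor `ℓ` has `c_M(ℓ) ≠ 0`, and NO non-zero class of the system has
depth `0`. So `t_p = 0` PREDICTS the depth table's bit — for SOME `(K, ℓ, M)`, not for a prescribed
row. The witness of the core form has `ν(n) + 1 = 2`, and a square-free `n` with one prime factor is
prime (`prime_of_squarefree_of_card_primeFactors_eq_one`). CONDITIONAL on the six facts; per-curve;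
BSD is not proved by it. [cite: BurungaleEtAl2026, Thm. 1 (arXiv:2312.09301 §0.1)]
[cite: Kolyvagin1991MathAnn, §2 Thm. 4] [cite: WZhang2014, Notations (xii) (p. 202)] -/
theorem exists_kolyvaginPrime_class_ne_zero_of_shaCorank_eq_zero_of_rank_two
    (hA : BurungaleEtAl2026_exists_kolyvaginClass_ne_zero)
    (hF : Kolyvagin1991_selmerCorank_of_kolyvaginClass_ne_zero)
    (hmod : exists_isNewformOf) (hHL : HoffsteinLuo1997_exists_twist_L_one_ne_zero)
    (hBFH : bumpFriedbergHoffstein_exists_heegnerField_split_twist_simpleZero)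
    (hGZK : rank_eq_analyticRank_of_analyticRank_le_one)
    (W : WeierstrassCurve ℚ) [W.IsElliptic] [W.IsGloballyMinimal] (hr : W.mordellWeilRank = 2)
    (p : ℕ) [hp : Fact p.Prime] (h5 : 5 ≤ p) (hgood : W.HasGoodReductionAtPrime p)
    (hord : ¬ (p : ℤ) ∣ W.frobeniusTrace p) (hsurj : W.HasSurjectiveModNGaloisRep p)
    (ht : W.shaCorank p = 0) :
    ∃ (K : Type) (_ : Field K) (_ : NumberField K), IsImaginaryQuadratic K ∧
      NumberField.discr K ≠ -3 ∧ NumberField.discr K ≠ -4 ∧ ¬ ((p : ℤ) ∣ NumberField.discr K) ∧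
      ¬ (p ∣ W.conductorNorm ℤ) ∧ ∃ (_ : NeZero (W.conductorNorm ℤ)),
      SatisfiesHeegnerHypothesis (W.conductorNorm ℤ) K ∧
      ∃ (Dt : ModularParametrizationData W (W.conductorNorm ℤ)) (β : ℤ) (ι : K →+* ℂ) (ℓ : ℕ)
        (d : KolyvaginHeegnerData Dt β ι ℓ) (M : ℕ),
        ℓ.Prime ∧ Zhang2014.IsKolyvaginPrime (W.conductorNorm ℤ) W K p ℓ ∧
        1 ≤ M ∧ (M : ℕ∞) ≤ Zhang2014.levelIndex W p ℓ ∧ d.kolyvaginClass hp.out M ≠ 0 ∧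
        (∀ (n' : ℕ) (d' : KolyvaginHeegnerData Dt β ι n') (M' : ℕ),
          KolyvaginDescent.KolSupp (Zhang2014.IsKolyvaginPrime (W.conductorNorm ℤ) W K p) n' →
          1 ≤ M' → (M' : ℕ∞) ≤ Zhang2014.levelIndex W p n' → d'.kolyvaginClass hp.out M' ≠ 0 →
          1 ≤ n'.primeFactors.card) := by
  obtain ⟨K, iF, iN, hK, h3, h4, hpd, hpN, iNZ, hH, Dt, β, ι, n, d, M, hΛ, hM, hMle, hne, hmin, hcard,
    -⟩ :=
    exists_heegnerField_minimal_class_of_shaCorank_eq_zero_of_two_le_rank hA hF hmod hHL hBFH hGZK W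
      hr.ge p h5 hgood hord hsurj ht
  have hν : n.primeFactors.card = 1 := by omega
  have hprime : n.Prime := prime_of_squarefree_of_card_primeFactors_eq_one hΛ.1 hν
  refine ⟨K, iF, iN, hK, h3, h4, hpd, hpN, iNZ, hH, Dt, β, ι, n, d, M, hprime, ?_, hM, hMle, hne, ?_⟩
  · exact hΛ.2 n (Nat.mem_primeFactors.mpr ⟨hprime, dvd_rfl, hprime.ne_zero⟩)
  · intro n' d' M' hΛ' hM' hM'le hne'
    rw [← hν]
    exact hmin n' d' M' hΛ' hM' hM'le hne'

/-! ## §2 The λ-join: a cell of the `p`-adic atlas gives the crux's clause at its curve -/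

/-- **The λ-join (cyclotomic certificate ⟹ the crux's clause at the curve).** Named facts: the six
of §1 (`hA hF hmod hHL hBFH hGZK`) and `hPRS` (Perrin-Riou–Schneider `ord_T char = rank` criterion,
BMS Thm. 1.7, the atlas's binder). Data: a curve `C` of the tree's `p`-adic atlas passing its kernel
test (`C.check`), a cell `c ∈ C.cells` (prime `p := c.p ≥ 5`, good ORDINARY — kernel point count),
`W = C.e ⊗ ℚ` elliptic and globally minimal; the atlas row's named hypotheses VERBATIM — the newform
`hf`, Kato 17.4 for all cyclotomic data `hkato`, the census rank certificate `hlow : 2 ≤ rank` (a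
kernel theorem for every depth-table curve), the symbol DATA `D, hD, hint, htab` (the tabulated
numerators ARE `D·[u/p^{n+1}]⁺`, `D·[u/p^n]⁺`) — and `ρ̄_{E,p}` onto. Conclusion: the clause of
`KolyvaginDepthSupply` at `W` (verbatim; `kolyvaginDepthSupply_iff_forall_clause`). Proof: the atlas
row (`AtlasCurve.padicRow`: kernel-checked Riemann sum ⟹ `[T²]L_p ≠ 0` ⟹ `rank = 2 = corank
Sel_{p^∞}` under `hPRS`, `hkato`) and the proved Kummer/Greenberg identity `corank Sel = rank + t_p`
give `t_p = 0`; then §1. CONDITIONAL on seven named facts and the symbol data; per-curve; BSD is not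
proved by it. [cite: SteinWuthrich2013, Thm. 1.1 and §3] [cite: MazurTateTeitelbaum1986Invent, §I.10–I.13]
[cite: Kato2004Asterisque, Thm. 17.4 (p. 273)] [cite: BalakrishnanMullerStein2015, Thm. 1.7]
[cite: BurungaleEtAl2026, Thm. 1 (arXiv:2312.09301 §0.1)] [cite: Kolyvagin1991MathAnn, §2 Thm. 4] -/
theorem kolyvaginDepthSupply_clause_of_atlasCell
    (hA : BurungaleEtAl2026_exists_kolyvaginClass_ne_zero)
    (hF : Kolyvagin1991_selmerCorank_of_kolyvaginClass_ne_zero)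
    (hmod : exists_isNewformOf) (hHL : HoffsteinLuo1997_exists_twist_L_one_ne_zero)
    (hBFH : bumpFriedbergHoffstein_exists_heegnerField_split_twist_simpleZero)
    (hGZK : rank_eq_analyticRank_of_analyticRank_le_one) (hPRS : Schneider1985_order_charGenerator)
    {C : AtlasCurve} (hC : C.check = true) {c : AtlasCell} (hc : c ∈ C.cells) [hp : Fact c.p.Prime]
    (W : WeierstrassCurve ℚ) [W.IsElliptic] [W.IsGloballyMinimal] (hW : W = C.e.baseChange ℚ)
    {N : ℕ} [NeZero N] {f : CuspForm (Gamma0 N) 2} (hf : IsNewformOf W f)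
    (hkato : ∀ (κ : ZpExtension ℚ c.p) (γ : Field.absoluteGaloisGroup ℚ),
      kato_divisibility W c.p (κ := κ) (γ := γ) (f := f))
    (hlow : 2 ≤ C.row.curve.mordellWeilRank) (D : ℚ) (hD : ‖(D : ℚ_[c.p])‖ = 1)
    (hint : ∀ x : ℚ, ‖(ratPlusSymbol f x : ℚ_[c.p])‖ ≤ 1)
    (htab : ∀ u : ℕ, u < c.p ^ (c.n + 1) → ¬ c.p ∣ u →
      ratPlusSymbol f ((u : ℚ) / (c.p : ℚ) ^ (c.n + 1)) = (c.tabHi.getD u 0 : ℚ) / D ∧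
      ratPlusSymbol f ((u : ℚ) / (c.p : ℚ) ^ c.n) = (c.tabLo.getD (u % c.p ^ c.n) 0 : ℚ) / D)
    (hsurj : W.HasSurjectiveModNGaloisRep c.p) :
    ∃ (p : ℕ) (hp : Fact p.Prime), 5 ≤ p ∧ W.HasGoodReductionAtPrime p ∧ ¬ (p : ℤ) ∣
      W.frobeniusTrace p ∧ W.HasSurjectiveModNGaloisRep p ∧ ∃ (K : Type) (_ : Field K) (_ :
      NumberField K), Literature.NumberTheory.EllipticCurves.IsImaginaryQuadratic K ∧
      NumberField.discr K ≠ -3 ∧ NumberField.discr K ≠ -4 ∧ ¬ ((p : ℤ) ∣ NumberField.discr K) ∧ ¬ (p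
      ∣ W.conductorNorm ℤ) ∧ ∃ (_ : NeZero (W.conductorNorm ℤ)),
      Literature.NumberTheory.EllipticCurves.SatisfiesHeegnerHypothesis (W.conductorNorm ℤ) K ∧ ∃
      (Dt : Literature.NumberTheory.EllipticCurves.ModularForms.ModularParametrizationData W
      (W.conductorNorm ℤ)) (β : ℤ) (ι : K →+* ℂ) (n : ℕ) (d :
      Literature.NumberTheory.EllipticCurves.KolyvaginHeegnerData Dt β ι n) (M : ℕ),
      Literature.NumberTheory.EllipticCurves.KolyvaginDescent.KolSupp
      (Literature.NumberTheory.EllipticCurves.Zhang2014.IsKolyvaginPrime (W.conductorNorm ℤ) W K p)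
      n ∧ 1 ≤ M ∧ (M : ℕ∞) ≤ Literature.NumberTheory.EllipticCurves.Zhang2014.levelIndex W p n ∧
      d.kolyvaginClass hp.out M ≠ 0 ∧ (∀ (n' : ℕ) (d' :
      Literature.NumberTheory.EllipticCurves.KolyvaginHeegnerData Dt β ι n') (M' : ℕ),
      Literature.NumberTheory.EllipticCurves.KolyvaginDescent.KolSupp
      (Literature.NumberTheory.EllipticCurves.Zhang2014.IsKolyvaginPrime (W.conductorNorm ℤ) W K p)
      n' → 1 ≤ M' → (M' : ℕ∞) ≤ Literature.NumberTheory.EllipticCurves.Zhang2014.levelIndex W p n' →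
      d'.kolyvaginClass hp.out M' ≠ 0 → n.primeFactors.card ≤ n'.primeFactors.card) ∧
      ((n.primeFactors.card + 1 = W.mordellWeilRank ∧ (W.quadraticTwist (NumberField.discr K :
      ℚ)).mordellWeilRank < W.mordellWeilRank) ∨ (n.primeFactors.card = W.mordellWeilRank ∧
      (W.quadraticTwist (NumberField.discr K : ℚ)).mordellWeilRank = W.mordellWeilRank + 1)) := by
  subst hW
  have hk : c.check C.e = true := AtlasCurve.cell_check hC hc
  have h5 : 5 ≤ c.p := AtlasCell.five_le_of_check hk
  obtain ⟨hgood, hord⟩ := AtlasCell.isOrdinaryAt_of_check hk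
  obtain ⟨hr2, -, -, -, hsel⟩ := AtlasCurve.padicRow hC hc hPRS hf hkato hlow D hD hint htab
  have hr2' : (C.e.baseChange ℚ).mordellWeilRank = 2 := by rw [AtlasCurve.baseChange_e]; exact hr2
  have hid : (C.e.baseChange ℚ).selmerCorank c.p =
      (C.e.baseChange ℚ).mordellWeilRank + (C.e.baseChange ℚ).shaCorank c.p :=
    (C.e.baseChange ℚ).selmerCorank_eq_mordellWeilRank_add_holds c.p
  have ht : (C.e.baseChange ℚ).shaCorank c.p = 0 := by omega
  exact kolyvaginDepthSupply_clause_of_shaCorank_eq_zero_of_two_le_rank hA hF hmod hHL hBFH hGZK _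
    (by omega) c.p h5 hgood hord hsurj ht

/-- **The λ-join, prime-witness form.** Same data as `kolyvaginDepthSupply_clause_of_atlasCell`;
conclusion: for some admissible Heegner field `K`, frame, Kolyvagin PRIME `ℓ` and level
`1 ≤ M ≤ M(ℓ)`, a Kolyvagin–Heegner datum of conductor `ℓ` on `W = C.e ⊗ ℚ` has `c_M(ℓ) ≠ 0`, and no
non-zero class of the system has depth `0` — the depth table's bit PREDICTED from the cyclotomic
certificate (for some `(K, ℓ, M)`). CONDITIONAL on seven named facts and the symbol data;
per-curve; BSD is not proved by it. [cite: SteinWuthrich2013, Thm. 1.1 and §3]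
[cite: BurungaleEtAl2026, Thm. 1 (arXiv:2312.09301 §0.1)] [cite: Kolyvagin1991MathAnn, §2 Thm. 4] -/
theorem exists_kolyvaginPrime_class_ne_zero_of_atlasCell
    (hA : BurungaleEtAl2026_exists_kolyvaginClass_ne_zero)
    (hF : Kolyvagin1991_selmerCorank_of_kolyvaginClass_ne_zero)
    (hmod : exists_isNewformOf) (hHL : HoffsteinLuo1997_exists_twist_L_one_ne_zero)
    (hBFH : bumpFriedbergHoffstein_exists_heegnerField_split_twist_simpleZero)
    (hGZK : rank_eq_analyticRank_of_analyticRank_le_one) (hPRS : Schneider1985_order_charGenerator)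
    {C : AtlasCurve} (hC : C.check = true) {c : AtlasCell} (hc : c ∈ C.cells) [hp : Fact c.p.Prime]
    (W : WeierstrassCurve ℚ) [W.IsElliptic] [W.IsGloballyMinimal] (hW : W = C.e.baseChange ℚ)
    {N : ℕ} [NeZero N] {f : CuspForm (Gamma0 N) 2} (hf : IsNewformOf W f)
    (hkato : ∀ (κ : ZpExtension ℚ c.p) (γ : Field.absoluteGaloisGroup ℚ),
      kato_divisibility W c.p (κ := κ) (γ := γ) (f := f))
    (hlow : 2 ≤ C.row.curve.mordellWeilRank) (D : ℚ) (hD : ‖(D : ℚ_[c.p])‖ = 1)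
    (hint : ∀ x : ℚ, ‖(ratPlusSymbol f x : ℚ_[c.p])‖ ≤ 1)
    (htab : ∀ u : ℕ, u < c.p ^ (c.n + 1) → ¬ c.p ∣ u →
      ratPlusSymbol f ((u : ℚ) / (c.p : ℚ) ^ (c.n + 1)) = (c.tabHi.getD u 0 : ℚ) / D ∧
      ratPlusSymbol f ((u : ℚ) / (c.p : ℚ) ^ c.n) = (c.tabLo.getD (u % c.p ^ c.n) 0 : ℚ) / D)
    (hsurj : W.HasSurjectiveModNGaloisRep c.p) :
    ∃ (K : Type) (_ : Field K) (_ : NumberField K), IsImaginaryQuadratic K ∧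
      NumberField.discr K ≠ -3 ∧ NumberField.discr K ≠ -4 ∧ ¬ ((c.p : ℤ) ∣ NumberField.discr K) ∧
      ¬ (c.p ∣ W.conductorNorm ℤ) ∧ ∃ (_ : NeZero (W.conductorNorm ℤ)),
      SatisfiesHeegnerHypothesis (W.conductorNorm ℤ) K ∧
      ∃ (Dt : ModularParametrizationData W (W.conductorNorm ℤ)) (β : ℤ) (ι : K →+* ℂ) (ℓ : ℕ)
        (d : KolyvaginHeegnerData Dt β ι ℓ) (M : ℕ),
        ℓ.Prime ∧ Zhang2014.IsKolyvaginPrime (W.conductorNorm ℤ) W K c.p ℓ ∧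
        1 ≤ M ∧ (M : ℕ∞) ≤ Zhang2014.levelIndex W c.p ℓ ∧ d.kolyvaginClass hp.out M ≠ 0 ∧
        (∀ (n' : ℕ) (d' : KolyvaginHeegnerData Dt β ι n') (M' : ℕ),
          KolyvaginDescent.KolSupp (Zhang2014.IsKolyvaginPrime (W.conductorNorm ℤ) W K c.p) n' →
          1 ≤ M' → (M' : ℕ∞) ≤ Zhang2014.levelIndex W c.p n' → d'.kolyvaginClass hp.out M' ≠ 0 →
          1 ≤ n'.primeFactors.card) := by
  subst hW
  have hk : c.check C.e = true := AtlasCurve.cell_check hC hc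
  have h5 : 5 ≤ c.p := AtlasCell.five_le_of_check hk
  obtain ⟨hgood, hord⟩ := AtlasCell.isOrdinaryAt_of_check hk
  obtain ⟨hr2, -, -, -, hsel⟩ := AtlasCurve.padicRow hC hc hPRS hf hkato hlow D hD hint htab
  have hr2' : (C.e.baseChange ℚ).mordellWeilRank = 2 := by rw [AtlasCurve.baseChange_e]; exact hr2
  have hid : (C.e.baseChange ℚ).selmerCorank c.p =
      (C.e.baseChange ℚ).mordellWeilRank + (C.e.baseChange ℚ).shaCorank c.p :=
    (C.e.baseChange ℚ).selmerCorank_eq_mordellWeilRank_add_holds c.p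
  have ht : (C.e.baseChange ℚ).shaCorank c.p = 0 := by omega
  exact exists_kolyvaginPrime_class_ne_zero_of_shaCorank_eq_zero_of_rank_two hA hF hmod hHL hBFH hGZK
    _ hr2' c.p h5 hgood hord hsurj ht

end Summit.BirchSwinnertonDyer.BirchSwinnertonDyer.Theorems.KolyvaginDepthDoor

end
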